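import Summits.MatrixMultiplication.OmegaCensus.STPPAlignedInvolutionClash

/-!
# ω-census (abelian STPP census): lemmas for the order-three clash (N20) — uniqueness of the order-3 subgroup when `9 ∤ |H|`

HONEST FRAMING (pub-omega census; verbatim): lottery ticket; floor = certified bounds/negative ranges.
Census BOOKKEEPING (seat pub-omega-stpp-1 gen 27, 2026-08-27), family (b2).  Pure group/sumset lemmas, no STPP content; customer:
`STPPAlignedOrderThreeClash.lean`.  Nothing here bears on `ω`.

* `mem_span_of_three_torsion` — in a finite abelian `H` with `9 ∤ |H|`, if `x ≠ 0`, `3•x = 0`, `3•y = 0` then `y ∈ {0, x, 2•x}` (else the nine elements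
  `i•x + j•y` form a subgroup of order `9`; Lagrange).  Helpers `mod_three_nsmul`, `threeSpan`, `threeSpan_add`, `threeSpan_eq_zero`.
* `exists_order_three_of_card_addStab_eq_three` — a stabilizer of cardinality `3` is `{0, κ, 2κ}` with `κ ≠ 0`, `3κ = 0`.
* `exists_pair_of_card_add_lt_three` — if `0, k, 2k ∈ K` and `|T + K| < 3|T|` then `T` has two points differing by `k` or `2k`.

References: M. B. Nathanson, *Additive Number Theory: Inverse Problems*, GTM 165, §4.1 (stabilizers).
-/

open Finset
open scoped Pointwise

namespace Summit.MatrixMultiplication.OmegaCensus.CubeNB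

variable {H : Type*} [AddCommGroup H] [DecidableEq H] [Fintype H]

/-! ## §1 At most one subgroup of order three -/

section ThreeTorsion


omit [DecidableEq H] [Fintype H] in
/-- `(m % 3) • x = m • x` when `3 • x = 0`. [folklore] -/
theorem mod_three_nsmul {x : H} (h3 : 3 • x = 0) (m : ℕ) : (m % 3) • x = m • x := by
  have key : (3 * (m / 3)) • x = 0 := by rw [mul_nsmul, h3, nsmul_zero]
  conv_rhs => rw [← Nat.mod_add_div m 3, add_nsmul, key, add_zero]

/-- The candidate subgroup elements `i•x + j•y`. [folklore] -/
def threeSpan (x y : H) (p : ℕ × ℕ) : H := p.1 • x + p.2 • y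

omit [DecidableEq H] [Fintype H] in
/-- Addition of span elements, exponents reduced mod 3. [folklore] -/
theorem threeSpan_add {x y : H} (h3x : 3 • x = 0) (h3y : 3 • y = 0) (i j i' j' : ℕ) :
    threeSpan x y (i, j) + threeSpan x y (i', j') = threeSpan x y ((i + i') % 3, (j + j') % 3) := by
  simp only [threeSpan, mod_three_nsmul h3x, mod_three_nsmul h3y, add_nsmul]
  abel

omit [DecidableEq H] [Fintype H] in
/-- `i•x + j•y = 0` with `i, j < 3` forces `i = j = 0` when `y ∉ {0, x, 2x}`. [folklore] -/
theorem threeSpan_eq_zero {x y : H} (hx : x ≠ 0) (h3x : 3 • x = 0) (h3y : 3 • y = 0) (hy0 : y ≠ 0) (hy1 : y ≠ x) (hy2 : y ≠ 2 • x)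
    {i j : ℕ} (hi : i < 3) (hj : j < 3) (h : threeSpan x y (i, j) = 0) : i = 0 ∧ j = 0 := by
  simp only [threeSpan] at h
  have e3x : 2 • x + x = 0 := by rw [← succ_nsmul]; exact h3x
  have e3y : 2 • y + y = 0 := by rw [← succ_nsmul]; exact h3y
  have hneg2x : -(2 • x) = x := neg_eq_of_add_eq_zero_right e3x
  have hnegx : -x = 2 • x := neg_eq_of_add_eq_zero_left e3x
  have hneg2y : -(2 • y) = y := neg_eq_of_add_eq_zero_right e3y
  have hx2 : 2 • x ≠ 0 := fun h2 => hx (by rw [← hneg2x, h2, neg_zero])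
  interval_cases i <;> interval_cases j <;> (try simp only [zero_nsmul, one_nsmul, add_zero, zero_add] at h)
  · exact ⟨rfl, rfl⟩
  · exact absurd h hy0
  · exact absurd (by rw [← hneg2y, h, neg_zero] : y = 0) hy0
  · exact absurd h hx
  · -- x + y = 0 ⇒ y = -x = 2•x
    exact absurd (by rw [← hnegx]; exact (neg_eq_of_add_eq_zero_right h).symm) hy2
  · -- x + 2•y = 0 ⇒ 2•y = -x ⇒ y = -(2•y) = x
    refine absurd ?_ hy1
    have h' : -x = 2 • y := neg_eq_of_add_eq_zero_right h
    rw [← hneg2y, ← h', neg_neg]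
  · exact absurd h hx2
  · -- 2•x + y = 0 ⇒ y = -(2•x) = x
    exact absurd (by rw [← hneg2x]; exact (neg_eq_of_add_eq_zero_right h).symm) hy1
  · -- 2•x + 2•y = 0 ⇒ x + y = 0 ⇒ y = 2•x
    refine absurd ?_ hy2
    have h2 : 2 • (x + y) = 0 := by rw [nsmul_add]; exact h
    have e3 : 2 • (x + y) + (x + y) = 0 := by rw [← succ_nsmul, nsmul_add, h3x, h3y, add_zero]
    have hxy : x + y = 0 := by rw [h2, zero_add] at e3; exact e3
    rw [← hnegx]; exact (neg_eq_of_add_eq_zero_right hxy).symm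

/-- **At most one subgroup of order 3 when `9 ∤ |H|`.**  In a finite abelian group with `9 ∤ |H|`, an element `y` with `3y = 0` lies in `{0, x, 2x}` for any
`x ≠ 0` with `3x = 0` (otherwise `{i•x + j•y}` is a subgroup of order `9`; Lagrange). [folklore] -/
theorem mem_span_of_three_torsion (h9 : ¬ 9 ∣ Fintype.card H) {x y : H} (hx : x ≠ 0) (h3x : 3 • x = 0) (h3y : 3 • y = 0) :
    y = 0 ∨ y = x ∨ y = 2 • x := by
  by_contra hcon
  push Not at hcon
  obtain ⟨hy0, hy1, hy2⟩ := hcon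
  let P : Finset (ℕ × ℕ) := (Finset.range 3) ×ˢ (Finset.range 3)
  let D : Finset H := P.image (threeSpan x y)
  have hmemP : ∀ p : ℕ × ℕ, p ∈ P ↔ p.1 < 3 ∧ p.2 < 3 := by
    intro p; simp [P, Finset.mem_product, Finset.mem_range]
  have hinj : Set.InjOn (threeSpan x y) (P : Set (ℕ × ℕ)) := by
    rintro ⟨i, j⟩ hp ⟨i', j'⟩ hp' heq
    have hp2 := (hmemP _).1 (by exact_mod_cast hp)
    have hp2' := (hmemP _).1 (by exact_mod_cast hp')
    simp only at hp2 hp2'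
    have h0 : threeSpan x y (i', j') + threeSpan x y ((3 - i') % 3, (3 - j') % 3) = 0 := by
      rw [threeSpan_add h3x h3y]
      have h1 : (i' + (3 - i') % 3) % 3 = 0 := by omega
      have h2 : (j' + (3 - j') % 3) % 3 = 0 := by omega
      rw [h1, h2]; simp [threeSpan]
    have h1 : threeSpan x y ((i + (3 - i') % 3) % 3, (j + (3 - j') % 3) % 3) = 0 := by
      rw [← threeSpan_add h3x h3y i j, heq, h0]
    have := threeSpan_eq_zero hx h3x h3y hy0 hy1 hy2 (Nat.mod_lt _ (by norm_num)) (Nat.mod_lt _ (by norm_num)) h1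
    have hi : i = i' := by omega
    have hj : j = j' := by omega
    rw [hi, hj]
  have hDcard : #D = 9 := by
    rw [Finset.card_image_of_injOn hinj]; simp [P]
  have hDadd : ∀ u ∈ D, ∀ v ∈ D, u + v ∈ D := by
    intro u hu v hv
    obtain ⟨⟨i, j⟩, hp, rfl⟩ := Finset.mem_image.1 hu
    obtain ⟨⟨i', j'⟩, hq, rfl⟩ := Finset.mem_image.1 hv
    rw [threeSpan_add h3x h3y]
    exact Finset.mem_image.2 ⟨_, (hmemP _).2 ⟨Nat.mod_lt _ (by norm_num), Nat.mod_lt _ (by norm_num)⟩, rfl⟩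
  have hD0 : (0 : H) ∈ D := Finset.mem_image.2 ⟨(0, 0), (hmemP _).2 ⟨by norm_num, by norm_num⟩, by simp [threeSpan]⟩
  have hDneg : ∀ u ∈ D, -u ∈ D := by
    intro u hu
    obtain ⟨⟨i, j⟩, hp, rfl⟩ := Finset.mem_image.1 hu
    have hp2 := (hmemP _).1 hp
    simp only at hp2
    have hsum : threeSpan x y (i, j) + threeSpan x y ((3 - i) % 3, (3 - j) % 3) = 0 := by
      rw [threeSpan_add h3x h3y]
      have h1 : (i + (3 - i) % 3) % 3 = 0 := by omega
      have h2 : (j + (3 - j) % 3) % 3 = 0 := by omega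
      rw [h1, h2]; simp [threeSpan]
    rw [neg_eq_of_add_eq_zero_right hsum]
    exact Finset.mem_image.2 ⟨((3 - i) % 3, (3 - j) % 3), (hmemP _).2 ⟨Nat.mod_lt _ (by norm_num), Nat.mod_lt _ (by norm_num)⟩, rfl⟩
  let K : AddSubgroup H :=
    { carrier := ↑D
      add_mem' := fun {u v} hu hv => by exact_mod_cast hDadd u (by exact_mod_cast hu) v (by exact_mod_cast hv)
      zero_mem' := by exact_mod_cast hD0
      neg_mem' := fun {u} hu => by exact_mod_cast hDneg u (by exact_mod_cast hu) }
  have hKcard : Nat.card K = #D := by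
    rw [← Nat.card_eq_finsetCard]; rfl
  have hdvd : Nat.card K ∣ Nat.card H := AddSubgroup.card_addSubgroup_dvd_card K
  rw [hKcard, hDcard, Nat.card_eq_fintype_card] at hdvd
  exact h9 hdvd


end ThreeTorsion

/-! ## §2 Stabilizers of order three and the three-coset pigeonhole -/

section Lemmas

omit [Fintype H] in
/-- A stabilizer of cardinality `3` is `{0, κ, κ + κ}` with `κ ≠ 0` and `κ + κ + κ = 0`. [cite: Nathanson1996, §4.1] -/
theorem exists_order_three_of_card_addStab_eq_three {s : Finset H} (hs : s.Nonempty) (h3 : #s.addStab = 3) :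
    ∃ κ : H, κ ≠ 0 ∧ κ + κ + κ = 0 ∧ κ ∈ s.addStab ∧ κ + κ ∈ s.addStab := by
  have h0 : (0 : H) ∈ s.addStab := Finset.zero_mem_addStab.2 hs
  have hcl : ∀ u ∈ s.addStab, ∀ v ∈ s.addStab, u + v ∈ s.addStab := by
    intro u hu v hv
    rw [Finset.mem_addStab hs] at hu hv ⊢
    rw [← vadd_vadd, hv, hu]
  obtain ⟨κ, hκ⟩ : (s.addStab.erase 0).Nonempty := by
    rw [← Finset.card_pos, Finset.card_erase_of_mem h0, h3]; norm_num
  have hκ0 : κ ≠ 0 := Finset.ne_of_mem_erase hκ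
  have hκm : κ ∈ s.addStab := Finset.mem_of_mem_erase hκ
  have h2κm : κ + κ ∈ s.addStab := hcl κ hκm κ hκm
  have h3κm : κ + κ + κ ∈ s.addStab := hcl _ h2κm κ hκm
  -- κ + κ ∉ {0, κ}
  have h2κ0 : κ + κ ≠ 0 := by
    intro h2
    -- then {0, κ} ⊊ stab: pick μ ∉ {0, κ}; μ + κ ∈ stab forces a contradiction
    obtain ⟨μ, hμ⟩ : ((s.addStab.erase 0).erase κ).Nonempty := by
      rw [← Finset.card_pos, Finset.card_erase_of_mem (Finset.mem_erase.2 ⟨hκ0, hκm⟩), Finset.card_erase_of_mem h0, h3]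
      norm_num
    have hμκ : μ ≠ κ := Finset.ne_of_mem_erase hμ
    have hμ0 : μ ≠ 0 := Finset.ne_of_mem_erase (Finset.mem_of_mem_erase hμ)
    have hμm : μ ∈ s.addStab := Finset.mem_of_mem_erase (Finset.mem_of_mem_erase hμ)
    have hμκm : μ + κ ∈ s.addStab := hcl μ hμm κ hκm
    -- s.addStab = {0, κ, μ}
    have hset : s.addStab ⊆ {0, κ, μ} := by
      intro z hz
      by_contra hzn
      simp only [Finset.mem_insert, Finset.mem_singleton, not_or] at hzn
      have h4 : ({0, κ, μ, z} : Finset H) ⊆ s.addStab := by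
        intro w hw
        simp only [Finset.mem_insert, Finset.mem_singleton] at hw
        rcases hw with rfl | rfl | rfl | rfl
        · exact h0
        · exact hκm
        · exact hμm
        · exact hz
      have hc4 : #({0, κ, μ, z} : Finset H) = 4 := by
        rw [Finset.card_insert_of_notMem, Finset.card_insert_of_notMem, Finset.card_pair]
        · exact fun h => hzn.2.2 h.symm
        · simp only [Finset.mem_insert, Finset.mem_singleton, not_or]; exact ⟨hμκ.symm, fun h => hzn.2.1 h.symm⟩
        · simp only [Finset.mem_insert, Finset.mem_singleton, not_or]; exact ⟨hκ0.symm, hμ0.symm, fun h => hzn.1 h.symm⟩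
      have := Finset.card_le_card h4
      omega
    have hμκ' := hset hμκm
    simp only [Finset.mem_insert, Finset.mem_singleton] at hμκ'
    rcases hμκ' with h | h | h
    · -- μ + κ = 0 ⇒ μ = -κ = κ (as κ + κ = 0)
      exact hμκ (by rw [neg_eq_of_add_eq_zero_left h |>.symm]; exact (neg_eq_of_add_eq_zero_left h2).symm ▸ rfl)
    · exact hμ0 (by simpa using h)
    · exact hκ0 (by simpa using h)
  have h2κκ : κ + κ ≠ κ := fun h => hκ0 (by simpa using h)
  -- s.addStab = {0, κ, κ+κ}, so κ+κ+κ ∈ {0, κ, κ+κ} forces κ+κ+κ = 0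
  have hset : s.addStab ⊆ {0, κ, κ + κ} := by
    intro z hz
    by_contra hzn
    simp only [Finset.mem_insert, Finset.mem_singleton, not_or] at hzn
    have h4 : ({0, κ, κ + κ, z} : Finset H) ⊆ s.addStab := by
      intro w hw
      simp only [Finset.mem_insert, Finset.mem_singleton] at hw
      rcases hw with rfl | rfl | rfl | rfl
      · exact h0
      · exact hκm
      · exact h2κm
      · exact hz
    have hc4 : #({0, κ, κ + κ, z} : Finset H) = 4 := by
      rw [Finset.card_insert_of_notMem, Finset.card_insert_of_notMem, Finset.card_pair]
      · exact fun h => hzn.2.2 h.symm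
      · simp only [Finset.mem_insert, Finset.mem_singleton, not_or]; exact ⟨h2κκ.symm, fun h => hzn.2.1 h.symm⟩
      · simp only [Finset.mem_insert, Finset.mem_singleton, not_or]; exact ⟨hκ0.symm, h2κ0.symm, fun h => hzn.1 h.symm⟩
    have := Finset.card_le_card h4
    omega
  have h3' := hset h3κm
  simp only [Finset.mem_insert, Finset.mem_singleton] at h3'
  rcases h3' with h | h | h
  · exact ⟨κ, hκ0, h, hκm, h2κm⟩
  · exact absurd (by simpa using h : κ + κ = 0) h2κ0
  · exact absurd (by simpa [add_assoc] using h : κ = 0) hκ0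

omit [Fintype H] in
/-- If `0, k, k + k ∈ K` and `|T + K| < 3|T|` then `T` contains two points differing by `k` or by `k + k` (the three translates `T`, `T + k`, `T + 2k` cannot be
pairwise disjoint inside `T + K`). [folklore] -/
theorem exists_pair_of_card_add_lt_three {T K : Finset H} {k : H} (h0 : (0 : H) ∈ K) (hk : k ∈ K) (h2k : k + k ∈ K)
    (hlt : #(T + K) < 3 * #T) : ∃ x ∈ T, ∃ g : H, (g = k ∨ g = k + k) ∧ x + g ∈ T := by
  by_contra h
  push Not at h
  have hk1 : ∀ x ∈ T, x + k ∉ T := fun x hx => (h x hx k (Or.inl rfl))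
  have hk2 : ∀ x ∈ T, x + (k + k) ∉ T := fun x hx => (h x hx (k + k) (Or.inr rfl))
  have hsub0 : T ⊆ T + K := fun x hx => Finset.mem_add.2 ⟨x, hx, 0, h0, add_zero x⟩
  have hsub1 : T.image (fun x => x + k) ⊆ T + K := by
    intro y hy; obtain ⟨x, hx, rfl⟩ := Finset.mem_image.1 hy; exact Finset.mem_add.2 ⟨x, hx, k, hk, rfl⟩
  have hsub2 : T.image (fun x => x + (k + k)) ⊆ T + K := by
    intro y hy; obtain ⟨x, hx, rfl⟩ := Finset.mem_image.1 hy; exact Finset.mem_add.2 ⟨x, hx, k + k, h2k, rfl⟩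
  have hd01 : Disjoint T (T.image fun x => x + k) := by
    rw [Finset.disjoint_left]; intro y hy hy'
    obtain ⟨x, hx, rfl⟩ := Finset.mem_image.1 hy'; exact hk1 x hx hy
  have hd02 : Disjoint T (T.image fun x => x + (k + k)) := by
    rw [Finset.disjoint_left]; intro y hy hy'
    obtain ⟨x, hx, rfl⟩ := Finset.mem_image.1 hy'; exact hk2 x hx hy
  have hd12 : Disjoint (T.image fun x => x + k) (T.image fun x => x + (k + k)) := by
    rw [Finset.disjoint_left]; intro y hy hy'
    obtain ⟨x, hx, rfl⟩ := Finset.mem_image.1 hy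
    obtain ⟨x', hx', hxx⟩ := Finset.mem_image.1 hy'
    -- x' + (k + k) = x + k ⇒ x = x' + k ∈ T
    have hx'k : x' + k = x := by
      apply add_right_cancel (b := k)
      rw [add_assoc]; exact hxx
    exact hk1 x' hx' (hx'k ▸ hx)
  have hcard : #(T ∪ T.image (fun x => x + k) ∪ T.image (fun x => x + (k + k))) = #T + #T + #T := by
    rw [Finset.card_union_of_disjoint (Finset.disjoint_union_left.2 ⟨hd02, hd12⟩), Finset.card_union_of_disjoint hd01,
      Finset.card_image_of_injective _ (add_left_injective k), Finset.card_image_of_injective _ (add_left_injective (k + k))]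
  have := Finset.card_le_card (Finset.union_subset (Finset.union_subset hsub0 hsub1) hsub2)
  omega

end Lemmas

end Summit.MatrixMultiplication.OmegaCensus.CubeNB
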